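import Summits.CriticalPhenomena.PercolationContinuityZ3.Theorems.Transplant.PlanarSkeletonFrmScaledCoarse
import Summits.CriticalPhenomena.PercolationContinuityZ3.Theorems.Transplant.SkelPhiCylBallFrom
import HarnessLib

/-!
# The coarse chart of a one-type SCALED skeleton, part 2: COARSE CYLINDERS ARE CONNECTED FROM WIDTH `max ℓ₀ 1` ON, AT EVERY VERTEX —
# the dictionary entry (κ′) `Skelφ.CylConnFrom G ⌊φ/N⌋ T (max ℓ₀ 1)` for any type set `T` (skeleton geometry only; RULING D-s (c), part 2)

builds on p205010 (kernel theorem, internal audit signed; external expert review pending) — nothing in this file uses p205010, and NOTHING is claimed about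
any open node (U_s, U, the end state): no node, no statement, no `@[conjecture]`.  Lane `prim-bschramm`, seat `prim-bschramm-p3` gen 25 (N2 design owner;
P3-NILPOTENT §18.3 (α), lead g20 RULING D-s (c): the coarse-chart reduction as GO-independent geometry — part 1 is «PlanarSkeletonFrmScaledCoarse», p430694);
helper file (`--supports stmt-CriticalPhenomena-4575 --as helper`); PROOFS ONLY, def-free.

For `Φ : PlanarSkeletonFrmScaled G` with ONE type (`Φ.types = {t}`; fields: `L`-Lipschitz chart, translating frames, EXACT single-edge `N`-steps, fine cylinders
connected from half-width `ℓ₀` on):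
* §1 `induce_fineCyl_connected`: fine cylinders at EVERY vertex are connected from `ℓ₀` on (frame transport of the field (κ′) along `exists_fineFrame`);
* §2 the `N`-STEP DESCENT inside a coarse cylinder `C = cyl ⌊φ/N⌋ v ℓ` (`ℓ ≥ 1`): a vertex of `C` whose `i`-th fine coordinate differs from `φ v i` by `≥ N` has a
  neighbour IN `C` one exact `N`-step closer (`exists_step_closer`), hence (`reach_adjust`, strong induction) every `w ∈ C` is joined INSIDE `C` to a vertex within
  fine distance `< N` of `φ v` in coordinate `i` with the other coordinate unchanged, and (`reach_near`) to a vertex of the fine cylinder `cyl φ v (N − 1)`;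
* §3 **`coarse_cyl_connected`: for `ℓ ≥ max ℓ₀ 1` the coarse cylinder `cyl ⌊φ/N⌋ v ℓ` at EVERY vertex `v` induces a connected subgraph** (descend to the fine
  cylinder `cyl φ v (max ℓ₀ N) ⊆ C`, connected by §1), hence **`coarse_cylConnFrom : Skelφ.CylConnFrom G Φ.coarse T (max Φ.ℓ₀ 1)` for EVERY finite `T`** — with
  part 1's `coarse_dictionary` the coarse chart of a one-type scaled skeleton with `L ≤ N` carries ALL FOUR structural entries of LEVEL 0's φ-level dictionary in their
  multi-type / (κ′) forms (`Lip`, `Steps`, `Frames` over `≤ N²` homogeneous residue types, `CylConnFrom`): `coarse_dictionary_from`.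
[cite: KozmaNitzan2024, §4 p. 15 (boxes and their translates), p. 16 (Lemma 8)] [cite: BenjaminiSchramm1996, Conj. 4; §2] [cite: MartineauTassion2017, §3.2]
-/

noncomputable section

namespace Summit.CriticalPhenomena.PercolationContinuityZ3.Theorems.Transplant

open Literature.Probability.LatticeModels SimpleGraph
open Literature.Probability.Percolation.GrimmettMarstrand1990 (induceIso)
open scoped Classical

namespace PlanarSkeletonFrmScaled

variable {V : Type} {G : SimpleGraph V} [G.LocallyFinite] (Φ : PlanarSkeletonFrmScaled G)

/-! ## §0 Membership in a cylinder, coordinatewise -/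

/-- `w ∈ cyl ψ v ℓ` iff every coordinate of `ψ w − ψ v` has absolute value `≤ ℓ`. [folklore] -/
theorem mem_cyl_iff_abs {ψ : V → Site 2} {v w : V} {ℓ : ℕ} : w ∈ Skelφ.cyl ψ v ℓ ↔ ∀ j : Fin 2, |ψ w j - ψ v j| ≤ ℓ := by
  rw [Skelφ.mem_cyl, mem_box]
  simp only [Pi.sub_apply, abs_le]

/-! ## §1 Fine cylinders at every vertex are connected from `ℓ₀` on -/

/-- **Fine cylinders at EVERY vertex of a one-type scaled skeleton are connected from half-width `ℓ₀` on** (the field (κ′) at the base vertex, transported along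
the fine-translating automorphism `t ↦ v` of `exists_fineFrame`). [cite: KozmaNitzan2024, §4 p. 15 (boxes and their translates)] -/
theorem induce_fineCyl_connected {t : V} (h1 : Φ.types = {t}) (v : V) {ℓ : ℕ} (hℓ : Φ.ℓ₀ ≤ ℓ) : (G.induce (Skelφ.cyl Φ.φ v ℓ)).Connected := by
  obtain ⟨β, hβt, hβ⟩ := Φ.exists_fineFrame h1 t v
  have ht : t ∈ Φ.types := by rw [h1]; exact Finset.mem_singleton_self t
  have hc := Φ.cyl_connected t ht ℓ hℓ
  have e : G.induce {w | Φ.φ w - Φ.φ t ∈ box 2 ℓ} ≃g G.induce (Skelφ.cyl Φ.φ v ℓ) :=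
    induceIso β fun w => by
      rw [Set.mem_setOf_eq, Skelφ.mem_cyl, hβ w]
      have e : Φ.φ w + (Φ.φ v - Φ.φ t) - Φ.φ v = Φ.φ w - Φ.φ t := by abel
      rw [e]
  exact e.connected_iff.1 hc

/-! ## §2 The `N`-step descent inside a coarse cylinder -/

/-- **One exact `N`-step closer, inside the coarse cylinder**: if `w ∈ C = cyl ⌊φ/N⌋ v ℓ` (`ℓ ≥ 1`) and `|φ w i − φ v i| ≥ N`, some neighbour `w'` of `w` lies in `C`,
has `|φ w' i − φ v i| = |φ w i − φ v i| − N` and the same other coordinate. [cite: KozmaNitzan2024, §4 p. 16 (Lemma 8)] -/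
theorem exists_step_closer {v w : V} {ℓ : ℕ} (hℓ : 1 ≤ ℓ) (hw : w ∈ Skelφ.cyl Φ.coarse v ℓ) (i : Fin 2) (hfar : (Φ.N : ℤ) ≤ |Φ.φ w i - Φ.φ v i|) :
    ∃ w', G.Adj w w' ∧ w' ∈ Skelφ.cyl Φ.coarse v ℓ ∧ |Φ.φ w' i - Φ.φ v i| = |Φ.φ w i - Φ.φ v i| - Φ.N ∧ ∀ j, j ≠ i → Φ.φ w' j = Φ.φ w j := by
  have hN := Φ.N_pos
  have hwC := (mem_cyl_iff_abs.1 hw)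
  by_cases hs : 0 ≤ Φ.φ w i - Φ.φ v i
  · -- `w` is ABOVE `v` in coordinate `i` by at least `N`: step down
    rw [abs_of_nonneg hs] at hfar
    obtain ⟨w', hadj, hφ⟩ := Φ.step w i (-1)
    have hi : Φ.φ w' i = Φ.φ w i - Φ.N := by
      rw [hφ, Pi.add_apply, Pi.single_eq_same, Units.val_neg, Units.val_one]; ring
    have hj : ∀ j, j ≠ i → Φ.φ w' j = Φ.φ w j := fun j hj => by rw [hφ, Pi.add_apply, Pi.single_eq_of_ne hj, add_zero]
    refine ⟨w', hadj, ?_, ?_, hj⟩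
    · rw [mem_cyl_iff_abs]
      intro j
      by_cases hji : j = i
      · subst hji
        have hcw := hwC j
        have hc' : Φ.coarse w' j = Φ.coarse w j - 1 := by
          rw [coarse_apply, coarse_apply, hi, show Φ.φ w j - (Φ.N : ℤ) = Φ.φ w j + (-1) * Φ.N by ring, Int.add_mul_ediv_right _ _ hN.ne']; ring
        have hge : Φ.coarse v j + 1 ≤ Φ.coarse w j := by
          rw [coarse_apply, coarse_apply, ← Int.add_mul_ediv_right _ _ hN.ne']
          exact Int.ediv_le_ediv hN (by linarith)
        rw [hc', abs_le] at *
        constructor <;> linarith [hcw.1, hcw.2]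
      · rw [coarse_apply, coarse_apply, hj j hji, ← coarse_apply, ← coarse_apply]; exact hwC j
    · rw [hi, abs_of_nonneg hs, abs_of_nonneg (by linarith)]; ring
  · -- `w` is BELOW `v` in coordinate `i` by at least `N`: step up
    have hs : Φ.φ w i - Φ.φ v i < 0 := lt_of_not_ge hs
    rw [abs_of_neg hs] at hfar
    obtain ⟨w', hadj, hφ⟩ := Φ.step w i 1
    have hi : Φ.φ w' i = Φ.φ w i + Φ.N := by
      rw [hφ, Pi.add_apply, Pi.single_eq_same, Units.val_one, mul_one]
    have hj : ∀ j, j ≠ i → Φ.φ w' j = Φ.φ w j := fun j hj => by rw [hφ, Pi.add_apply, Pi.single_eq_of_ne hj, add_zero]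
    refine ⟨w', hadj, ?_, ?_, hj⟩
    · rw [mem_cyl_iff_abs]
      intro j
      by_cases hji : j = i
      · subst hji
        have hcw := hwC j
        have hc' : Φ.coarse w' j = Φ.coarse w j + 1 := by
          rw [coarse_apply, coarse_apply, hi, show Φ.φ w j + (Φ.N : ℤ) = Φ.φ w j + 1 * Φ.N by ring, Int.add_mul_ediv_right _ _ hN.ne']
        have hle : Φ.coarse w j + 1 ≤ Φ.coarse v j := by
          rw [coarse_apply, coarse_apply, ← Int.add_mul_ediv_right _ _ hN.ne']
          exact Int.ediv_le_ediv hN (by linarith)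
        rw [hc', abs_le] at *
        constructor <;> linarith [hcw.1, hcw.2]
      · rw [coarse_apply, coarse_apply, hj j hji, ← coarse_apply, ← coarse_apply]; exact hwC j
    · rw [hi, abs_of_neg hs, abs_of_nonpos (by linarith)]; ring

/-- **Descent in one coordinate** (strong induction on `|φ w i − φ v i|`): every `w ∈ C = cyl ⌊φ/N⌋ v ℓ` (`ℓ ≥ 1`) is joined INSIDE `C` to a vertex `w' ∈ C` with
`|φ w' i − φ v i| < N` and the other coordinate unchanged. [cite: KozmaNitzan2024, §4 p. 16 (Lemma 8)] -/
theorem reach_adjust {v : V} {ℓ : ℕ} (hℓ : 1 ≤ ℓ) (i : Fin 2) :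
    ∀ (n : ℕ) (w : V) (hw : w ∈ Skelφ.cyl Φ.coarse v ℓ), (Φ.φ w i - Φ.φ v i).natAbs ≤ n →
      ∃ (w' : V) (hw' : w' ∈ Skelφ.cyl Φ.coarse v ℓ), (G.induce (Skelφ.cyl Φ.coarse v ℓ)).Reachable ⟨w, hw⟩ ⟨w', hw'⟩ ∧
        |Φ.φ w' i - Φ.φ v i| < Φ.N ∧ ∀ j, j ≠ i → Φ.φ w' j = Φ.φ w j := by
  intro n
  induction n using Nat.strong_induction_on with
  | _ n ih =>
    intro w hw hn
    by_cases hnear : |Φ.φ w i - Φ.φ v i| < Φ.N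
    · exact ⟨w, hw, Reachable.refl _, hnear, fun j _ => rfl⟩
    · have hfar : (Φ.N : ℤ) ≤ |Φ.φ w i - Φ.φ v i| := not_lt.mp hnear
      obtain ⟨w₁, hadj, hw₁, habs, hj⟩ := Φ.exists_step_closer hℓ hw i hfar
      have hlt : (Φ.φ w₁ i - Φ.φ v i).natAbs < n := by
        have h1 : ((Φ.φ w₁ i - Φ.φ v i).natAbs : ℤ) = |Φ.φ w₁ i - Φ.φ v i| := Int.natCast_natAbs _
        have h2 : ((Φ.φ w i - Φ.φ v i).natAbs : ℤ) = |Φ.φ w i - Φ.φ v i| := Int.natCast_natAbs _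
        have hN := Φ.N_pos
        omega
      obtain ⟨w', hw', hreach, hnear', hj'⟩ := ih _ hlt w₁ hw₁ le_rfl
      refine ⟨w', hw', ?_, hnear', fun j hji => by rw [hj' j hji, hj j hji]⟩
      have hadj' : (G.induce (Skelφ.cyl Φ.coarse v ℓ)).Adj ⟨w, hw⟩ ⟨w₁, hw₁⟩ := SimpleGraph.induce_adj.2 hadj
      exact hadj'.reachable.trans hreach

/-- **Descent in both coordinates**: every `w ∈ C = cyl ⌊φ/N⌋ v ℓ` (`ℓ ≥ 1`) is joined INSIDE `C` to a vertex of the FINE cylinder `cyl φ v (N − 1)`.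
[cite: KozmaNitzan2024, §4 p. 16 (Lemma 8)] -/
theorem reach_near {v : V} {ℓ : ℕ} (hℓ : 1 ≤ ℓ) {w : V} (hw : w ∈ Skelφ.cyl Φ.coarse v ℓ) :
    ∃ (w' : V) (hw' : w' ∈ Skelφ.cyl Φ.coarse v ℓ), (G.induce (Skelφ.cyl Φ.coarse v ℓ)).Reachable ⟨w, hw⟩ ⟨w', hw'⟩ ∧
      w' ∈ Skelφ.cyl Φ.φ v (Φ.N - 1) := by
  obtain ⟨w₁, hw₁, hr₁, hn₁, -⟩ := Φ.reach_adjust hℓ 0 _ w hw le_rfl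
  obtain ⟨w₂, hw₂, hr₂, hn₂, hj₂⟩ := Φ.reach_adjust hℓ 1 _ w₁ hw₁ le_rfl
  refine ⟨w₂, hw₂, hr₁.trans hr₂, ?_⟩
  have h1N := Φ.one_le_N
  have hcast : ((Φ.N - 1 : ℕ) : ℤ) = (Φ.N : ℤ) - 1 := by rw [Nat.cast_sub h1N, Nat.cast_one]
  rw [mem_cyl_iff_abs, Fin.forall_fin_two, hcast, hj₂ 0 (by decide)]
  rw [abs_lt] at hn₁ hn₂
  rw [abs_le, abs_le]
  omega

/-! ## §3 Coarse cylinders are connected from width `max ℓ₀ 1` on, at every vertex -/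

/-- **COARSE CYLINDERS ARE CONNECTED (one type, every vertex, half-width `ℓ ≥ max ℓ₀ 1`).**  Every `w` of `C = cyl ⌊φ/N⌋ v ℓ` descends inside `C` by exact
`N`-steps to the fine cylinder `cyl φ v (max ℓ₀ N)`, which is connected (§1) and contained in `C` (`cyl φ v (Nℓ) ⊆ C`, part 1's sandwich).
[cite: KozmaNitzan2024, §4 p. 15 (boxes and their translates), p. 16 (Lemma 8)] -/
theorem coarse_cyl_connected {t : V} (h1 : Φ.types = {t}) (v : V) {ℓ : ℕ} (hℓ : max Φ.ℓ₀ 1 ≤ ℓ) :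
    (G.induce (Skelφ.cyl Φ.coarse v ℓ)).Connected := by
  have hℓ1 : 1 ≤ ℓ := le_trans (le_max_right _ _) hℓ
  have hℓ0 : Φ.ℓ₀ ≤ ℓ := le_trans (le_max_left _ _) hℓ
  set C := Skelφ.cyl Φ.coarse v ℓ with hC
  -- the fine cylinder of half-width `m = max ℓ₀ N` at `v`: connected and inside `C`
  set m : ℕ := max Φ.ℓ₀ Φ.N with hm
  have hmconn : (G.induce (Skelφ.cyl Φ.φ v m)).Connected := Φ.induce_fineCyl_connected h1 v (le_max_left _ _)
  have hmN : m ≤ Φ.N * ℓ := by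
    refine max_le ?_ ?_
    · exact hℓ0.trans (Nat.le_mul_of_pos_left ℓ Φ.one_le_N)
    · exact Nat.le_mul_of_pos_right _ hℓ1
  have hsub : Skelφ.cyl Φ.φ v m ⊆ C := (Skelφ.cyl_mono Φ.φ v hmN).trans (Φ.cyl_fine_subset_coarse v ℓ)
  have hvC : v ∈ C := Skelφ.self_mem_cyl Φ.coarse v ℓ
  -- every vertex of `C` is reachable from `v` inside `C`
  have key : ∀ x : C, (G.induce C).Reachable ⟨v, hvC⟩ x := by
    rintro ⟨w, hw⟩
    obtain ⟨w', hw', hr, hnear⟩ := Φ.reach_near hℓ1 hw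
    -- `w'` lies in the fine cylinder of half-width `N − 1 ≤ m`
    have hw'm : w' ∈ Skelφ.cyl Φ.φ v m := Skelφ.cyl_mono Φ.φ v (by omega) hnear
    have hvm : v ∈ Skelφ.cyl Φ.φ v m := Skelφ.self_mem_cyl Φ.φ v m
    obtain ⟨W⟩ := hmconn.preconnected ⟨v, hvm⟩ ⟨w', hw'm⟩
    obtain ⟨W', -⟩ := Skel.exists_walk_induce_mono (G := G) hsub W
    exact (W'.reachable).trans hr.symm
  haveI : Nonempty C := ⟨⟨v, hvC⟩⟩
  exact ⟨fun x y => (key x).symm.trans (key y)⟩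

/-- **(κ′) FOR THE COARSE CHART: `Skelφ.CylConnFrom G ⌊φ/N⌋ T (max ℓ₀ 1)` for EVERY finite set `T` of base vertices** (one-type scaled skeleton; in particular for
the `≤ N²` residue types of part 1's `exists_coarseTypes`). [cite: KozmaNitzan2024, §4 p. 15 (boxes and their translates)] -/
theorem coarse_cylConnFrom {t : V} (h1 : Φ.types = {t}) (T : Finset V) : Skelφ.CylConnFrom G Φ.coarse T (max Φ.ℓ₀ 1) :=
  fun v _ _ hℓ => Φ.coarse_cyl_connected h1 v hℓ

/-- **SUMMARY — ALL FOUR structural dictionary entries for the coarse chart of a one-type scaled skeleton with `L ≤ N`**: `Skelφ.Lip`, `Skelφ.Steps`, and over at most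
`N²` HOMOGENEOUS residue types `T ∋ t`: `Skelφ.Frames G ⌊φ/N⌋ T` and `Skelφ.CylConnFrom G ⌊φ/N⌋ T (max ℓ₀ 1)`.  (What LEVEL 0 of the closed N2 node consumes, in the
multi-type / (κ′) form; no node is applied or claimed.) [cite: KozmaNitzan2024, §4 p. 16 (Lemma 8)] [cite: MartineauTassion2017, §3.2] -/
theorem coarse_dictionary_from {t : V} (h1 : Φ.types = {t}) (hLN : Φ.L ≤ Φ.N) :
    Skelφ.Lip G Φ.coarse ∧ Skelφ.Steps G Φ.coarse ∧
      ∃ T : Finset V, t ∈ T ∧ T.card ≤ Φ.N ^ 2 ∧ Skelφ.Frames G Φ.coarse T ∧ Skelφ.CylConnFrom G Φ.coarse T (max Φ.ℓ₀ 1) ∧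
        ∀ t₁ ∈ T, ∀ t₂ ∈ T, ∃ β : G ≃g G, β t₁ = t₂ ∧ ∀ w, Φ.φ (β w) = Φ.φ w + (Φ.φ t₂ - Φ.φ t₁) := by
  obtain ⟨T, htT, hcard, hfr, hhom⟩ := Φ.exists_coarseTypes h1
  exact ⟨Φ.coarse_lip hLN, Φ.steps_coarse, T, htT, hcard, hfr, Φ.coarse_cylConnFrom h1 T, hhom⟩

end PlanarSkeletonFrmScaled

end Summit.CriticalPhenomena.PercolationContinuityZ3.Theorems.Transplant

end
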